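import Mathlib
import Literature.NumberTheory.QuadraticFields.LenstraPomeranceCoprimePairs

/-!
# `LiouvilleOrthogonalTC0` (stmt-QuantumAdvantage-1393), line `Sketch` — stub `stub_factor`
# (factorisation into interval-local parts is a bijection)

For thresholds `z₀ ≤ z₁ ≤ … ≤ z_m` (a monotone `z : Fin (m+1) → ℕ`) and the interval-local parts
`u_i(N) = ∏_{p ∣ N, z_i < p ≤ z_{i+1}} p^{v_p(N)}` (`i : Fin m`, the skeleton's `locPart`, inlined):

1. every `N ≠ 0` all of whose prime factors lie in `(z₀, z_m]` is the product of its `m` local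
   parts (reconstruction);
2. every local part is nonzero and all its prime factors lie in `(z_i, z_{i+1}]` (locality);
3. if `u_i ≠ 0` is `(z_i, z_{i+1}]`-local for every `i`, then the `j`-th local part of `∏ u_i`
   is `u_j` (uniqueness).

Proved from Mathlib (`Nat.factorization`, `Nat.primeFactors`) and the tree's elementary `S`-part
lemmas `Literature.NumberTheory.QuadraticFields.BinaryQuadraticForm.primeFactors_prod_pow_factorization`
(prime factors of `∏_{p ∈ S} p^{v_p(N)}` are `S`): the half-open intervals `(z_i, z_{i+1}]` are
pairwise disjoint (monotonicity of `z`, `StubFactor.index_unique`) and cover `(z₀, z_m]`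
(`Fin.induction`, `StubFactor.index_exists`), so the filtered sets of prime factors partition
`N.primeFactors` and `Finset.prod_biUnion` with `Nat.prod_primeFactors_pow_factorization` give (1);
(2) is read off from the prime factors of an `S`-part; for (3), a prime factor of `∏ u_i` divides
some `u_i`, hence lies in the `i`-th interval, so filtering by the `j`-th interval leaves exactly
`(u_j).primeFactors`, on which `v_p(∏ u_i) = Σ_i v_p(u_i) = v_p(u_j)` (`Nat.factorization_prod`).
-/

set_option linter.dupNamespace false -- D-0017: single-problem summit ⇒ `QuantumAdvantage.QuantumAdvantage` by design

namespace Summit.QuantumAdvantage.QuantumAdvantage.Theorems.LiouvilleOrthogonalTC0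

open Finset
open Literature.NumberTheory.QuadraticFields.BinaryQuadraticForm
  (primeFactors_prod_pow_factorization)

namespace StubFactor

/-- Two intervals `(z_i, z_{i+1}]`, `(z_j, z_{j+1}]` of a monotone threshold sequence sharing a
point coincide: `i = j`. -/
theorem index_unique {m : ℕ} {z : Fin (m + 1) → ℕ} (hz : Monotone z) {p : ℕ} {i j : Fin m}
    (hi : z i.castSucc < p ∧ p ≤ z i.succ) (hj : z j.castSucc < p ∧ p ≤ z j.succ) : i = j := by
  by_contra h
  rcases lt_or_gt_of_ne h with h | h
  · have := hz (Fin.succ_le_castSucc_iff.mpr h)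
    omega
  · have := hz (Fin.succ_le_castSucc_iff.mpr h)
    omega

/-- The intervals `(z_i, z_{i+1}]`, `i : Fin m`, cover `(z₀, z_m]`. -/
theorem index_exists {m : ℕ} (z : Fin (m + 1) → ℕ) {p : ℕ} (h0 : z 0 < p)
    (hm : p ≤ z (Fin.last m)) : ∃ i : Fin m, z i.castSucc < p ∧ p ≤ z i.succ := by
  suffices H : ∀ k : Fin (m + 1), p ≤ z k → ∃ i : Fin m, z i.castSucc < p ∧ p ≤ z i.succ from
    H (Fin.last m) hm
  intro k
  induction k using Fin.induction with
  | zero => intro h; omega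
  | succ i ih =>
    intro h
    by_cases hi : p ≤ z i.castSucc
    · exact ih hi
    · exact ⟨i, not_le.mp hi, h⟩

/-- A local part `∏_{p ∣ N, y < p ≤ w} p^{v_p(N)}` is nonzero. -/
theorem locProd_ne_zero (N y w : ℕ) :
    (∏ p ∈ N.primeFactors.filter (fun p => y < p ∧ p ≤ w), p ^ N.factorization p) ≠ 0 :=
  Finset.prod_ne_zero_iff.mpr fun _ hp =>
    pow_ne_zero _ (Nat.prime_of_mem_primeFactors (Finset.mem_filter.mp hp).1).ne_zero

/-- The prime factors of the local part `∏_{p ∣ N, y < p ≤ w} p^{v_p(N)}` are the prime factors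
of `N` in `(y, w]`. -/
theorem primeFactors_locProd (N y w : ℕ) :
    (∏ p ∈ N.primeFactors.filter (fun p => y < p ∧ p ≤ w), p ^ N.factorization p).primeFactors =
      N.primeFactors.filter (fun p => y < p ∧ p ≤ w) :=
  primeFactors_prod_pow_factorization (Finset.filter_subset _ _)

end StubFactor

open StubFactor

/-- **Stub `stub_factor` (factorisation into interval-local parts is a bijection).** For a monotone
threshold sequence `z₀ ≤ z₁ ≤ … ≤ z_m`: (i) a nonzero `N` all of whose prime factors lie in
`(z₀, z_m]` is the product of its local parts `∏_{p ∣ N, z_i < p ≤ z_{i+1}} p^{v_p(N)}`; (ii) each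
local part is nonzero and `(z_i, z_{i+1}]`-local; (iii) the `j`-th local part of a product of
`(z_i, z_{i+1}]`-local numbers `u_i ≠ 0` is `u_j` (uniqueness). -/
theorem stub_factor (m : ℕ) (z : Fin (m + 1) → ℕ) (hz : Monotone z) :
    (∀ N : ℕ, N ≠ 0 → (∀ p ∈ N.primeFactors, z 0 < p ∧ p ≤ z (Fin.last m)) →
        ∏ i : Fin m, (∏ p ∈ N.primeFactors.filter (fun p => z i.castSucc < p ∧ p ≤ z i.succ),
          p ^ N.factorization p) = N) ∧
    (∀ N : ℕ, ∀ i : Fin m,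
        (∏ p ∈ N.primeFactors.filter (fun p => z i.castSucc < p ∧ p ≤ z i.succ),
            p ^ N.factorization p) ≠ 0 ∧
        ∀ r ∈ (∏ p ∈ N.primeFactors.filter (fun p => z i.castSucc < p ∧ p ≤ z i.succ),
            p ^ N.factorization p).primeFactors, z i.castSucc < r ∧ r ≤ z i.succ) ∧
    (∀ u : Fin m → ℕ, (∀ i, u i ≠ 0 ∧ ∀ r ∈ (u i).primeFactors, z i.castSucc < r ∧ r ≤ z i.succ) →
        ∀ j : Fin m,
          (∏ p ∈ (∏ i, u i).primeFactors.filter (fun p => z j.castSucc < p ∧ p ≤ z j.succ),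
            p ^ (∏ i, u i).factorization p) = u j) := by
  refine ⟨fun N hN hloc => ?_, fun N i => ⟨locProd_ne_zero N _ _, fun r hr => ?_⟩,
    fun u hu j => ?_⟩
  · -- (i) reconstruction: the filtered sets of prime factors partition `N.primeFactors`
    have hdisj : Set.PairwiseDisjoint (↑(Finset.univ : Finset (Fin m)))
        (fun i : Fin m => N.primeFactors.filter (fun p => z i.castSucc < p ∧ p ≤ z i.succ)) := by
      intro i _ j _ hij
      show Disjoint _ _
      refine Finset.disjoint_left.mpr fun p hpi hpj => hij ?_
      exact index_unique hz (Finset.mem_filter.mp hpi).2 (Finset.mem_filter.mp hpj).2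
    have hcover : (Finset.univ : Finset (Fin m)).biUnion
        (fun i : Fin m => N.primeFactors.filter (fun p => z i.castSucc < p ∧ p ≤ z i.succ)) =
        N.primeFactors := by
      ext p
      simp only [Finset.mem_biUnion, Finset.mem_univ, true_and, Finset.mem_filter]
      constructor
      · rintro ⟨i, hp, -⟩
        exact hp
      · intro hp
        obtain ⟨i, hi⟩ := index_exists z (hloc p hp).1 (hloc p hp).2
        exact ⟨i, hp, hi⟩
    rw [← Finset.prod_biUnion hdisj, hcover]
    exact (Nat.prod_primeFactors_pow_factorization hN).symm
  · -- (ii) locality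
    rw [primeFactors_locProd] at hr
    exact (Finset.mem_filter.mp hr).2
  · -- (iii) uniqueness
    have hP : (∏ i, u i) ≠ 0 := Finset.prod_ne_zero_iff.mpr fun i _ => (hu i).1
    have hfilter : (∏ i, u i).primeFactors.filter (fun p => z j.castSucc < p ∧ p ≤ z j.succ) =
        (u j).primeFactors := by
      ext p
      simp only [Finset.mem_filter]
      constructor
      · rintro ⟨hp, hpj⟩
        have hpp := Nat.prime_of_mem_primeFactors hp
        obtain ⟨i, -, hi⟩ :=
          (hpp.prime.dvd_finsetProd_iff u).mp (Nat.dvd_of_mem_primeFactors hp)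
        have hpi : p ∈ (u i).primeFactors := Nat.mem_primeFactors.mpr ⟨hpp, hi, (hu i).1⟩
        exact index_unique hz ((hu i).2 p hpi) hpj ▸ hpi
      · intro hp
        exact ⟨Nat.mem_primeFactors.mpr ⟨Nat.prime_of_mem_primeFactors hp,
          (Nat.dvd_of_mem_primeFactors hp).trans (Finset.dvd_prod_of_mem u (Finset.mem_univ j)),
          hP⟩, (hu j).2 p hp⟩
    have hfac : ∀ p ∈ (u j).primeFactors, (∏ i, u i).factorization p = (u j).factorization p := by
      intro p hp
      rw [Nat.factorization_prod fun i _ => (hu i).1, Finsupp.finsetSum_apply]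
      refine Fintype.sum_eq_single j fun i hij => ?_
      refine Nat.factorization_eq_zero_of_not_dvd fun hdvd => hij ?_
      have hpi : p ∈ (u i).primeFactors :=
        Nat.mem_primeFactors.mpr ⟨Nat.prime_of_mem_primeFactors hp, hdvd, (hu i).1⟩
      exact index_unique hz ((hu i).2 p hpi) ((hu j).2 p hp)
    rw [hfilter, Finset.prod_congr rfl fun p hp => by rw [hfac p hp]]
    exact (Nat.prod_primeFactors_pow_factorization (hu j).1).symm

end Summit.QuantumAdvantage.QuantumAdvantage.Theorems.LiouvilleOrthogonalTC0
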